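import Literature.AlgebraicGeometry.Resolution.RegularLocalRingsQuotient
import Literature.AlgebraicGeometry.Resolution.RegularLocalRingsNormal
import Mathlib.RingTheory.RegularLocalRing.Defs
import Mathlib.RingTheory.Localization.AtPrime.Basic
import Mathlib.RingTheory.Localization.Ideal
import Mathlib.RingTheory.Ideal.MinimalPrime.Basic
import Mathlib.RingTheory.IntegralClosure.IntegrallyClosed
import Mathlib.RingTheory.Nakayama
import Mathlib.Algebra.Polynomial.Taylor
import Mathlib.Algebra.BigOperators.Associated
import HarnessLib

/-!
# Mulay's `Λ`-ideal argument (Mulay 1983, §3.6–§3.9): simultaneous congruences forced by a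
# `d`-fold Taylor condition along finitely many height-one primes of a regular domain

Topic: `Literature/AlgebraicGeometry/Resolution`. This is the ring-theoretic core of S. B. Mulay,
*Equimultiplicity and hyperplanarity*, Proc. Amer. Math. Soc. **89** (1983) 407–413 (lit key
`paper:url-29aeafb0cf6c`, read 2026-08-27), namely Definition 3.6 (the ideal
`Λ(J) = {a ∈ B | aZ + β ∈ J for some β ∈ B}`), 3.8 (`Λ(J) ⊄ Q₁ ∪ ⋯ ∪ Qₙ`) and the key 3.9
(`Λ(J) = B`), extracted in the following SELF-CONTAINED form, which is what the proof of the Main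
Theorem (§4, p. 413) consumes.

**Theorem** (`exists_forall_add_mem_span_of_taylor`). Let `S` be a regular domain (Mathlib
`IsRegularRing`: Noetherian, all localisations at primes regular local), `q₁, …, qₙ ∈ S` pairwise
non-associated prime elements, `θ₁, …, θₙ ∈ S`, and `f ∈ S[Z]` monic of degree `d ≥ 1` such that
for every `i` and every `m ≤ d` the `m`-th Taylor coefficient of `f` at `θᵢ` lies in
`(qᵢ^{d−m})` (equivalently `f(Z) ∈ (Z − θᵢ, qᵢ)^d`, i.e. `f ≡ (Z − θᵢ)^d` to order `d` along the
prime `(Z − θᵢ, qᵢ)` — Mulay's 3.3 / the membership `Pᵢ ∈ Π(A, f(Z)A, d)`). Then there is ONE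
`τ ∈ S` with `θᵢ + τ ∈ (qᵢ)` for all `i`, i.e. `Z + τ ∈ ⋂ᵢ (Z − θᵢ, qᵢ)` (Mulay: `Λ(J) = B`).

Proof (Mulay 3.8–3.9, pp. 412–413, followed step by step). Let `Λ = {a | ∃ β, ∀ i, aθᵢ + β ∈ (qᵢ)}`
and suppose `1 ∉ Λ`. (3.8) `a₀ = Σⱼ ∏_{i≠j} qᵢ ∈ Λ ∖ ⋃ (qᵢ)`. (3.9) Take a minimal prime `𝔭 ⊇ Λ`;
prime avoidance gives `x ∈ 𝔭` outside every `(qᵢ)` and outside `𝔭⁽²⁾`; `R = S_𝔭` is regular and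
`R/xR` is a regular local ring, hence an integrally closed domain (Matsumura 14.2, 19.4 — the tree's
`IsRegularLocalRing.quotient_span_singleton`, `Matsumura1987_19_4_holds`); `ΛR` is `𝔭R`-primary,
so `x^e ∈ ΛR` with `e ≥ 1` least, `y = t x^e ∈ Λ` (`t ∉ 𝔭`), `yZ + β ∈ J`. The homogenised Taylor
identity `Σ_m f_m X^m Y^{d−m} = Σ_m (taylor θ f)_m Y^{d−m}(X − θY)^m`
(`sum_coeff_mul_pow_eq_sum_taylor_coeff`) at `(X, Y) = (−β, y)` shows
`E = Σ_m f_m (−β)^m y^{d−m} ∈ ⋂ (qᵢ^d) = ((∏ qᵢ)^d)` — display `(∗)` of p. 413 — while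
`E ≡ (−β)^d (mod x)`; in the normal domain `R/xR` this forces `∏ qᵢ ∣ β`, so `uβ = (∏ qᵢ)w + xv`
with `u ∉ 𝔭`, whence `(utx^{e−1})θᵢ + v ∈ (qᵢ)` for all `i` — display `(∗∗)` — contradicting the
minimality of `e`.

Consumer: the discharge of the named fact `Mulay1983_codimTwoHyperplanar`
(`Mulay1983Hyperplanarity.lean`), where `S = L⟦x₂,…,x_d⟧`, the `qᵢ` are the height-one primes
under the finitely many smooth equimultiple curves `Pᵢ = (z − θᵢ, qᵢ)` of a Weierstrass polynomial
`f`, and `z + τ` is the sought regular parameter. No statement of H. Hironaka's 2017 manuscript is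
involved. AI formalisation; weaker than expert review.

## References
* S. B. Mulay, *Equimultiplicity and hyperplanarity*, Proc. Amer. Math. Soc. 89 (1983) 407–413,
  Def. 3.6, 3.7, 3.8, 3.9 (pp. 411–413). [Mulay1983]
* H. Matsumura, *Commutative Ring Theory*, CUP 1986, Thm. 14.2, Thm. 19.4. [Matsumura1987]
-/

noncomputable section

namespace Literature.AlgebraicGeometry.Resolution

namespace Mulay1983

open IsLocalRing Polynomial Finset

universe u

variable {S : Type u} [CommRing S]

/-! ## The homogenised Taylor identity -/

/-- The homogenised Taylor identity: for `f ∈ S[X]` with `natDegree f ≤ d` and `x, y, θ ∈ S`,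
`Σ_{m ≤ d} f_m x^m y^{d−m} = Σ_{m ≤ d} (taylor θ f)_m · y^{d−m} · (x − θ y)^m`
(both sides are `y^d f(x/y)`; checked on monomials with the binomial theorem). This is the
division-free form of «`f(θ)a^d` … where `f(Z) = z^d + C₁z^{d−1} + ⋯ + C_d`» used in Mulay 3.3 and
in display `(∗)` of 3.9. [cite: Mulay1983, 3.3 and 3.9 display (∗), pp. 411–413] -/
theorem sum_coeff_mul_pow_eq_sum_taylor_coeff (f : S[X]) {d : ℕ} (hf : f.natDegree ≤ d)
    (x y θ : S) :
    ∑ m ∈ range (d + 1), f.coeff m * x ^ m * y ^ (d - m) =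
      ∑ m ∈ range (d + 1), (taylor θ f).coeff m * y ^ (d - m) * (x - θ * y) ^ m := by
  -- both sides are `S`-linear in `f`; reduce to monomials `X ^ n`, `n ≤ d`
  have key : ∀ n ≤ d, ∀ c : S,
      ∑ m ∈ range (d + 1), (monomial n c : S[X]).coeff m * x ^ m * y ^ (d - m) =
        ∑ m ∈ range (d + 1), (taylor θ (monomial n c)).coeff m * y ^ (d - m) * (x - θ * y) ^ m := by
    intro n hn c
    -- left-hand side: the single term `m = n`
    have hL : ∑ m ∈ range (d + 1), (monomial n c : S[X]).coeff m * x ^ m * y ^ (d - m) =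
        c * x ^ n * y ^ (d - n) := by
      rw [Finset.sum_eq_single n]
      · rw [coeff_monomial, if_pos rfl]
      · intro m _ hmn
        rw [coeff_monomial, if_neg (Ne.symm hmn), zero_mul, zero_mul]
      · intro h
        exact absurd (Finset.mem_range.mpr (Nat.lt_succ_of_le hn)) h
    -- right-hand side: binomial expansion of `((x - θ y) + θ y) ^ n`
    have hR : ∑ m ∈ range (d + 1), (taylor θ (monomial n c)).coeff m * y ^ (d - m) * (x - θ * y) ^ m =
        c * y ^ (d - n) * ∑ m ∈ range (n + 1), (x - θ * y) ^ m * (θ * y) ^ (n - m) * (n.choose m : S) := by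
      rw [taylor_monomial, Finset.mul_sum]
      -- restrict the left sum to `m ≤ n`
      have hd : d + 1 = (n + 1) + (d - n) := by omega
      rw [hd, Finset.sum_range_add]
      have hvan : ∑ m ∈ range (d - n),
          (C c * (X + C θ) ^ n).coeff (n + 1 + m) * y ^ (d - (n + 1 + m)) * (x - θ * y) ^ (n + 1 + m) = 0 := by
        refine Finset.sum_eq_zero fun m _ => ?_
        rw [coeff_C_mul, coeff_X_add_C_pow, Nat.choose_eq_zero_of_lt (by omega), Nat.cast_zero,
          mul_zero, mul_zero, zero_mul, zero_mul]
      rw [hvan, add_zero]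
      refine Finset.sum_congr rfl fun m hm => ?_
      have hmn : m ≤ n := Nat.lt_succ_iff.mp (Finset.mem_range.mp hm)
      rw [coeff_C_mul, coeff_X_add_C_pow]
      have hsplit : y ^ (d - m) = y ^ (d - n) * y ^ (n - m) := by
        rw [← pow_add]; congr 1; omega
      rw [hsplit, mul_pow]
      ring
    rw [hL, hR, ← add_pow, sub_add_cancel, mul_assoc, mul_assoc, mul_comm (y ^ (d - n)) (x ^ n)]
  -- write `f` as a sum of monomials of degree `≤ d`
  have hfsum : f = ∑ n ∈ range (d + 1), monomial n (f.coeff n) :=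
    as_sum_range' f (d + 1) (Nat.lt_succ_of_le hf)
  -- linearity of both sides in `f`
  have hlin : ∀ (g : ℕ → S[X]) (N : ℕ),
      (∑ m ∈ range (d + 1), (∑ n ∈ range N, g n).coeff m * x ^ m * y ^ (d - m)) =
        ∑ n ∈ range N, ∑ m ∈ range (d + 1), (g n).coeff m * x ^ m * y ^ (d - m) := by
    intro g N
    rw [Finset.sum_comm]
    refine Finset.sum_congr rfl fun m _ => ?_
    rw [finsetSum_coeff, Finset.sum_mul, Finset.sum_mul]
  have hlin' : ∀ (g : ℕ → S[X]) (N : ℕ),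
      (∑ m ∈ range (d + 1), (taylor θ (∑ n ∈ range N, g n)).coeff m * y ^ (d - m) * (x - θ * y) ^ m) =
        ∑ n ∈ range N, ∑ m ∈ range (d + 1),
          (taylor θ (g n)).coeff m * y ^ (d - m) * (x - θ * y) ^ m := by
    intro g N
    rw [Finset.sum_comm]
    refine Finset.sum_congr rfl fun m _ => ?_
    rw [map_sum, finsetSum_coeff, Finset.sum_mul, Finset.sum_mul]
  conv_lhs => rw [hfsum]
  conv_rhs => rw [hfsum]
  rw [hlin, hlin']
  refine Finset.sum_congr rfl fun n hn => ?_
  exact key n (Nat.lt_succ_iff.mp (Finset.mem_range.mp hn)) (f.coeff n)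

/-! ## Products of pairwise non-associated primes -/

/-- If pairwise non-associated prime elements `q i` (`i ∈ s`) all satisfy `q i ^ n ∣ a`, then
`(∏_{i ∈ s} q i) ^ n ∣ a` (repeated use of `Prime.pow_dvd_of_dvd_mul_left`; used for
«`I^d = (Q₁R)^d ∩ ⋯ ∩ (QₙR)^d`» in Mulay 3.9). [cite: Mulay1983, 3.9 p. 413] -/
theorem prod_pow_dvd_of_forall_pow_dvd [IsDomain S] {ι : Type*} (q : ι → S)
    (hq : ∀ i, Prime (q i)) (hqa : ∀ i j, Associated (q i) (q j) → i = j)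
    (s : Finset ι) (n : ℕ) {a : S} (ha : ∀ i ∈ s, q i ^ n ∣ a) : (∏ i ∈ s, q i) ^ n ∣ a := by
  classical
  induction s using Finset.induction_on generalizing a with
  | empty => simp
  | insert j s hj ih =>
    rw [Finset.prod_insert hj, mul_pow]
    obtain ⟨b, rfl⟩ := ih fun i hi => ha i (Finset.mem_insert_of_mem hi)
    -- `q j` does not divide the product of the other primes
    have hndvd : ¬ q j ∣ (∏ i ∈ s, q i) ^ n := by
      intro h
      have h1 := (hq j).dvd_of_dvd_pow h
      obtain ⟨i, hi, hij⟩ := (hq j).exists_mem_finset_dvd h1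
      have hass : Associated (q j) (q i) :=
        ((hq j).irreducible.dvd_irreducible_iff_associated (hq i).irreducible).mp hij
      exact hj ((hqa j i hass) ▸ hi)
    have hjn : q j ^ n ∣ (∏ i ∈ s, q i) ^ n * b := ha j (Finset.mem_insert_self j s)
    rw [mul_comm (q j ^ n)]
    exact mul_dvd_mul_left _ ((hq j).pow_dvd_of_dvd_mul_left n hndvd hjn)

/-! ## The `Λ`-ideal and Mulay 3.9 -/

/-- **Mulay 1983, 3.6–3.9 (the `Λ`-ideal argument).** Let `S` be a regular domain, `q i` (`i : ι`,
finitely many) pairwise non-associated prime elements, `θ i ∈ S`, and `f ∈ S[X]` monic of degree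
`d ≥ 1` whose Taylor coefficients satisfy `(taylor (θ i) f)_m ∈ (q i ^ (d - m))` for all `i` and all
`m ≤ d` (i.e. `f ∈ (X − θ i, q i)^d`, Mulay's `P_i ∈ Π(A, f(Z)A, d)` for `P_i = (Z − θ i, q i)`).
Then `Λ(⋂ P_i) = S` (Mulay 3.9): there is `τ ∈ S` with `θ i + τ ∈ (q i)` for every `i`, i.e.
`Z + τ ∈ P_i` for all `i`. [cite: Mulay1983, 3.9 (with 3.6–3.8), pp. 411–413] -/
theorem exists_forall_add_mem_span_of_taylor [IsDomain S] [IsRegularRing S] {ι : Type*} [Finite ι]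
    (q θ : ι → S) (hq : ∀ i, Prime (q i)) (hqa : ∀ i j, Associated (q i) (q j) → i = j)
    (f : S[X]) (hmon : f.Monic) (hd : 0 < f.natDegree)
    (hT : ∀ i, ∀ m ≤ f.natDegree,
      (taylor (θ i) f).coeff m ∈ Ideal.span {q i ^ (f.natDegree - m)}) :
    ∃ τ : S, ∀ i, θ i + τ ∈ Ideal.span {q i} := by
  classical
  haveI : IsNoetherianRing S := inferInstance
  cases isEmpty_or_nonempty ι with
  | inl _ => exact ⟨0, fun i => isEmptyElim i⟩
  | inr hne =>
  haveI := Fintype.ofFinite ι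
  set d := f.natDegree with hddef
  -- membership in `(q i)` is divisibility
  have hmem : ∀ (i : ι) (a : S), a ∈ Ideal.span {q i} ↔ q i ∣ a := fun i a => Ideal.mem_span_singleton
  -- Mulay's ideal `Λ` (Def. 3.6, in the explicit form of 3.7/3.8 with `η = 1`)
  let Λ : Ideal S :=
    { carrier := {a | ∃ β : S, ∀ i, a * θ i + β ∈ Ideal.span {q i}}
      add_mem' := by
        rintro a b ⟨β, hβ⟩ ⟨γ, hγ⟩
        refine ⟨β + γ, fun i => ?_⟩
        have : (a + b) * θ i + (β + γ) = (a * θ i + β) + (b * θ i + γ) := by ring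
        rw [this]; exact Ideal.add_mem _ (hβ i) (hγ i)
      zero_mem' := ⟨0, fun i => by rw [zero_mul, add_zero]; exact Ideal.zero_mem _⟩
      smul_mem' := by
        rintro c a ⟨β, hβ⟩
        refine ⟨c * β, fun i => ?_⟩
        have : c • a * θ i + c * β = c * (a * θ i + β) := by rw [smul_eq_mul]; ring
        rw [this]; exact Ideal.mul_mem_left _ _ (hβ i) }
  have hΛ : ∀ a : S, a ∈ Λ ↔ ∃ β : S, ∀ i, a * θ i + β ∈ Ideal.span {q i} := fun a => Iff.rfl
  -- it suffices that `1 ∈ Λ`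
  by_contra hcon
  push Not at hcon
  have h1 : (1 : S) ∉ Λ := by
    rintro ⟨τ, hτ⟩
    obtain ⟨i, hi⟩ := hcon τ
    exact hi (by simpa using hτ i)
  have hΛtop : Λ ≠ ⊤ := fun h => h1 (h ▸ Submodule.mem_top)
  -- (3.8) an element of `Λ` outside every `(q i)`
  set a₀ : S := ∑ j, ∏ i ∈ Finset.univ.erase j, q i with ha₀def
  have ha₀Λ : a₀ ∈ Λ := by
    refine (hΛ a₀).mpr ⟨-∑ j, (∏ i ∈ Finset.univ.erase j, q i) * θ j, fun i => ?_⟩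
    have : a₀ * θ i + -∑ j, (∏ k ∈ Finset.univ.erase j, q k) * θ j =
        ∑ j, (∏ k ∈ Finset.univ.erase j, q k) * (θ i - θ j) := by
      rw [ha₀def, Finset.sum_mul, ← sub_eq_add_neg, ← Finset.sum_sub_distrib]
      refine Finset.sum_congr rfl fun j _ => by ring
    rw [this]
    refine Ideal.sum_mem _ fun j _ => ?_
    by_cases hji : j = i
    · rw [hji, sub_self, mul_zero]; exact Ideal.zero_mem _
    · exact Ideal.mul_mem_right _ _ ((hmem i _).mpr
        (Finset.dvd_prod_of_mem q (Finset.mem_erase.mpr ⟨Ne.symm hji, Finset.mem_univ i⟩)))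
  have ha₀q : ∀ i, a₀ ∉ Ideal.span {q i} := by
    intro i hi
    -- the `j = i` summand is the only one not divisible by `q i`
    have hsplit : a₀ = (∏ k ∈ Finset.univ.erase i, q k) + ∑ j ∈ Finset.univ.erase i, ∏ k ∈ Finset.univ.erase j, q k := by
      rw [ha₀def, ← Finset.add_sum_erase _ _ (Finset.mem_univ i)]
    have hrest : (∑ j ∈ Finset.univ.erase i, ∏ k ∈ Finset.univ.erase j, q k) ∈ Ideal.span {q i} := by
      refine Ideal.sum_mem _ fun j hj => (hmem i _).mpr (Finset.dvd_prod_of_mem q ?_)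
      exact Finset.mem_erase.mpr ⟨(Finset.mem_erase.mp hj).1.symm, Finset.mem_univ i⟩
    have hprod : (∏ k ∈ Finset.univ.erase i, q k) ∈ Ideal.span {q i} := by
      have := Ideal.sub_mem _ hi hrest
      rwa [hsplit, add_sub_cancel_right] at this
    obtain ⟨k, hk, hik⟩ := (hq i).exists_mem_finset_dvd ((hmem i _).mp hprod)
    have hass : Associated (q i) (q k) :=
      ((hq i).irreducible.dvd_irreducible_iff_associated (hq k).irreducible).mp hik
    exact (Finset.mem_erase.mp hk).1 (hqa i k hass).symm
  have ha₀0 : a₀ ≠ 0 := by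
    obtain ⟨i⟩ := hne
    intro h; exact ha₀q i (h ▸ Ideal.zero_mem _)
  -- (3.9) a minimal prime `𝔭` over `Λ`
  obtain ⟨𝔭, h𝔭min⟩ := Ideal.nonempty_minimalPrimes hΛtop
  haveI h𝔭 : 𝔭.IsPrime := h𝔭min.1.1
  have hΛ𝔭 : Λ ≤ 𝔭 := h𝔭min.1.2
  have h𝔭q : ∀ i, ¬ 𝔭 ≤ Ideal.span {q i} := fun i h => ha₀q i (h (hΛ𝔭 ha₀Λ))
  -- the regular local ring `R = S_𝔭`
  set R := Localization.AtPrime 𝔭 with hRdef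
  let φ := algebraMap S R
  haveI : IsRegularLocalRing R := inferInstance
  have hφinj : Function.Injective φ :=
    IsLocalization.injective R 𝔭.primeCompl_le_nonZeroDivisors
  have hmax : maximalIdeal R = 𝔭.map φ := Localization.AtPrime.map_eq_maximalIdeal.symm
  have hφmem : ∀ s : S, φ s ∈ maximalIdeal R ↔ s ∈ 𝔭 := fun s =>
    IsLocalization.AtPrime.to_map_mem_maximal_iff R 𝔭 s
  have hunder : (maximalIdeal R).comap φ = 𝔭 := Ideal.ext fun s => by
    rw [Ideal.mem_comap]; exact hφmem s
  have hφunit : ∀ s : S, s ∉ 𝔭 → IsUnit (φ s) := fun s hs =>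
    (IsLocalization.AtPrime.isUnit_to_map_iff R 𝔭 s).mpr hs
  -- the "symbolic square" `𝔭⁽²⁾ = φ⁻¹(𝔪_R²)` and `𝔭 ⊄ 𝔭⁽²⁾`
  set 𝔭₂ : Ideal S := ((maximalIdeal R) ^ 2).comap φ with h𝔭₂def
  have h𝔭𝔭₂ : ¬ 𝔭 ≤ 𝔭₂ := by
    intro hle
    have hmm : maximalIdeal R ≤ (maximalIdeal R) ^ 2 :=
      calc maximalIdeal R = 𝔭.map φ := hmax
        _ ≤ (maximalIdeal R) ^ 2 := Ideal.map_le_iff_le_comap.mpr hle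
    have hbot : maximalIdeal R = ⊥ := by
      refine Submodule.eq_bot_of_le_smul_of_le_jacobson_bot (maximalIdeal R) (maximalIdeal R)
        (IsNoetherian.noetherian _) ?_ ?_
      · rw [Ideal.smul_eq_mul, ← pow_two]; exact hmm
      · rw [IsLocalRing.jacobson_eq_maximalIdeal ⊥ bot_ne_top]
    have : 𝔭 = ⊥ := by
      rw [← hunder, hbot]
      exact Ideal.comap_bot_of_injective φ hφinj
    exact ha₀0 (by simpa [this] using hΛ𝔭 ha₀Λ)
  -- prime avoidance: `x ∈ 𝔭` outside `𝔭⁽²⁾` and outside every `(q i)`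
  obtain ⟨x, hx𝔭, hx₂, hxq⟩ : ∃ x ∈ 𝔭, x ∉ 𝔭₂ ∧ ∀ i, x ∉ Ideal.span {q i} := by
    let F : Option ι → Ideal S := fun o => o.elim 𝔭₂ fun i => Ideal.span {q i}
    have hprime : ∀ o ∈ (Finset.univ : Finset ι).image some, (F o).IsPrime := by
      intro o ho
      obtain ⟨i, _, rfl⟩ := Finset.mem_image.mp ho
      exact (Ideal.span_singleton_prime (hq i).ne_zero).mpr (hq i)
    have hnot : ¬ ((𝔭 : Set S) ⊆ F none ∪ F none ∪ ⋃ o ∈ (↑((Finset.univ : Finset ι).image some) : Set (Option ι)), F o) := by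
      rw [Ideal.subset_union_prime' hprime]
      rintro (h | h | ⟨o, ho, h⟩)
      · exact h𝔭𝔭₂ h
      · exact h𝔭𝔭₂ h
      · obtain ⟨i, _, rfl⟩ := Finset.mem_image.mp ho
        exact h𝔭q i h
    obtain ⟨x, hx𝔭, hx⟩ := Set.not_subset.mp hnot
    refine ⟨x, hx𝔭, fun h => hx (Or.inl (Or.inl h)), fun i h => hx (Or.inr ?_)⟩
    exact Set.mem_iUnion₂.mpr ⟨some i, Finset.mem_coe.mpr (Finset.mem_image_of_mem _ (Finset.mem_univ i)), h⟩
  have hxdvd : ∀ i, ¬ q i ∣ x := fun i h => hxq i ((hmem i x).mpr h)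
  -- `x` is a regular parameter of `R`; `D = R/xR` is a regular local ring, a normal domain
  have hxm : φ x ∈ maximalIdeal R := (hφmem x).mpr hx𝔭
  have hxm2 : φ x ∉ (maximalIdeal R) ^ 2 := fun h => hx₂ (Ideal.mem_comap.mpr h)
  set D := R ⧸ Ideal.span {φ x} with hDdef
  have hDreg : IsRegularLocalRing D := (IsRegularLocalRing.quotient_span_singleton hxm hxm2).1
  obtain ⟨hDdom, hDic⟩ := Matsumura1987_19_4_holds D hDreg
  haveI := hDdom
  haveI := hDic
  let π : S →+* D := (Ideal.Quotient.mk (Ideal.span {φ x})).comp φ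
  have hπ : ∀ s, π s = Ideal.Quotient.mk (Ideal.span {φ x}) (φ s) := fun s => rfl
  -- `x ∈ rad(ΛR)`: `𝔭` is minimal over `Λ`
  set Λ' : Ideal R := Λ.map φ with hΛ'def
  have hΛ'le : Λ' ≤ maximalIdeal R := by rw [hmax]; exact Ideal.map_mono hΛ𝔭
  have hxrad : φ x ∈ Λ'.radical := by
    rw [Ideal.radical_eq_sInf, Ideal.mem_sInf]
    rintro P ⟨hΛ'P, hP⟩
    have hPne : P ≠ ⊤ := hP.ne_top
    have hPle : P.comap φ ≤ 𝔭 := by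
      intro s hs
      by_contra hs𝔭
      exact hPne (Ideal.eq_top_of_isUnit_mem _ (Ideal.mem_comap.mp hs) (hφunit s hs𝔭))
    have hΛP : Λ ≤ P.comap φ := Ideal.map_le_iff_le_comap.mp hΛ'P
    haveI := hP
    have hPeq : 𝔭 ≤ P.comap φ := h𝔭min.2 ⟨inferInstance, hΛP⟩ hPle
    exact Ideal.mem_comap.mp (hPeq hx𝔭)
  have hex : ∃ e : ℕ, φ x ^ e ∈ Λ' := hxrad
  let e := Nat.find hex
  have he : φ x ^ e ∈ Λ' := Nat.find_spec hex
  have hemin : ∀ e' < e, φ x ^ e' ∉ Λ' := fun e' he' => Nat.find_min hex he'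
  have he0 : e ≠ 0 := by
    intro h0
    have h1' : (1 : R) ∈ Λ' := by simpa [h0] using he
    exact (maximalIdeal.isMaximal R).ne_top (Ideal.eq_top_of_isUnit_mem _ (hΛ'le h1') isUnit_one)
  obtain ⟨e', hee'⟩ : ∃ e', e = e' + 1 := Nat.exists_eq_succ_of_ne_zero he0
  -- pull `x ^ e ∈ ΛR` back to `S`: `y = t x^e ∈ Λ` with `t ∉ 𝔭`
  obtain ⟨⟨⟨a, haΛ⟩, ⟨t, ht⟩⟩, hat⟩ := (IsLocalization.mem_map_algebraMap_iff 𝔭.primeCompl R).mp he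
  simp only at hat
  have hyΛ : t * x ^ e ∈ Λ := by
    have : φ (x ^ e * t) = φ a := by rw [map_mul, map_pow]; exact hat
    rw [mul_comm, hφinj this]; exact haΛ
  have ht𝔭 : t ∉ 𝔭 := ht
  obtain ⟨β, hβ⟩ := (hΛ _).mp hyΛ
  set y := t * x ^ e with hydef
  have hxy : x ∣ y := ⟨t * x ^ e', by rw [hydef, hee', pow_succ]; ring⟩
  -- the element `E = Σ f_m (−β)^m y^{d−m}` (display (∗)): divisible by every `q i ^ d`
  set E : S := ∑ m ∈ range (d + 1), f.coeff m * (-β) ^ m * y ^ (d - m) with hEdef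
  have hEq : ∀ i, q i ^ d ∣ E := by
    intro i
    rw [hEdef, sum_coeff_mul_pow_eq_sum_taylor_coeff f le_rfl (-β) y (θ i)]
    refine Finset.dvd_sum fun m hm => ?_
    have hmd : m ≤ d := Nat.lt_succ_iff.mp (Finset.mem_range.mp hm)
    have h1 : q i ^ (d - m) ∣ (taylor (θ i) f).coeff m := Ideal.mem_span_singleton.mp (hT i m hmd)
    have h2 : q i ∣ (-β - θ i * y) := by
      have : -β - θ i * y = -(y * θ i + β) := by ring
      rw [this, dvd_neg]; exact (hmem i _).mp (hβ i)
    have h3 : q i ^ (d - m) * q i ^ m ∣ (taylor (θ i) f).coeff m * y ^ (d - m) * (-β - θ i * y) ^ m :=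
      mul_dvd_mul (dvd_mul_of_dvd_left h1 _) (pow_dvd_pow_of_dvd h2 m)
    rwa [← pow_add, Nat.sub_add_cancel hmd] at h3
  set Q : S := ∏ i, q i with hQdef
  have hQE : Q ^ d ∣ E := prod_pow_dvd_of_forall_pow_dvd q hq hqa Finset.univ d fun i _ => hEq i
  obtain ⟨lam, hlam⟩ := hQE
  have hQ0 : Q ≠ 0 := Finset.prod_ne_zero_iff.mpr fun i _ => (hq i).ne_zero
  have hqQ : ∀ i, q i ∣ Q := fun i => Finset.dvd_prod_of_mem q (Finset.mem_univ i)
  -- `E ≡ (−β)^d (mod x)` since `x ∣ y` and `f` is monic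
  have hEβ : x ∣ E - (-β) ^ d := by
    have hsplit : E = (∑ m ∈ range d, f.coeff m * (-β) ^ m * y ^ (d - m)) + (-β) ^ d := by
      rw [hEdef, Finset.sum_range_succ, Nat.sub_self, pow_zero, mul_one]
      have : f.coeff d = 1 := hmon.coeff_natDegree
      rw [this, one_mul]
    rw [hsplit, add_sub_cancel_right]
    refine Finset.dvd_sum fun m hm => ?_
    have hmd : m < d := Finset.mem_range.mp hm
    obtain ⟨k, hk⟩ : ∃ k, d - m = k + 1 := Nat.exists_eq_succ_of_ne_zero (by omega)
    rw [hk, pow_succ]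
    exact Dvd.dvd.mul_left (Dvd.dvd.mul_left hxy _) _
  -- `Q ∉ xR`
  have hQx : π Q ≠ 0 := by
    intro h0
    rw [hπ, Ideal.Quotient.eq_zero_iff_mem, Ideal.mem_span_singleton] at h0
    obtain ⟨r, hr⟩ := h0
    obtain ⟨⟨rn, ⟨rs, hrs⟩⟩, hrmk⟩ := IsLocalization.mk'_surjective 𝔭.primeCompl r
    simp only at hrmk
    -- `Q * rs = x * rn` in `S`
    have hS : Q * rs = x * rn := by
      apply hφinj
      rw [map_mul, map_mul, hr, ← hrmk, mul_assoc, IsLocalization.mk'_spec_mk]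
    have hqrn : ∀ i, q i ∣ rn := fun i => by
      have h : q i ∣ x * rn := by rw [← hS]; exact (hqQ i).mul_right rs
      exact ((hq i).dvd_or_dvd h).resolve_left (hxdvd i)
    have hQrn : Q ∣ rn := by
      simpa only [pow_one] using
        prod_pow_dvd_of_forall_pow_dvd q hq hqa Finset.univ 1 (fun i _ => by rw [pow_one]; exact hqrn i)
    obtain ⟨r', rfl⟩ := hQrn
    have : rs = x * r' := mul_left_cancel₀ hQ0 (by rw [hS]; ring)
    exact hrs (this ▸ 𝔭.mul_mem_right _ hx𝔭)
  -- in the normal domain `D = R/xR`: `(−β̄)^d = Q̄^d · λ̄`, hence `Q̄ ∣ β̄`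
  have hπx : π x = 0 := by
    rw [hπ, Ideal.Quotient.eq_zero_iff_mem]; exact Ideal.mem_span_singleton_self _
  have hπdvd : ∀ {a b : S}, x ∣ a - b → π a = π b := by
    rintro a b ⟨c, hc⟩
    rw [← sub_eq_zero, ← map_sub, hc, map_mul, hπx, zero_mul]
  have hDeq : π (-β) ^ d = π Q ^ d * π lam := by
    rw [← map_pow, ← map_pow, ← map_mul, ← hlam]
    exact (hπdvd hEβ).symm
  have hQβ : π Q ∣ π (-β) := by
    rw [← IsIntegrallyClosed.pow_dvd_pow_iff (Nat.pos_iff_ne_zero.mp hd)]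
    exact ⟨π lam, hDeq⟩
  -- lift to `S`: `u β = Q w + x v` with `u ∉ 𝔭` (Mulay: "uβ − vx is in IB")
  obtain ⟨u, hu, w, v, huβ⟩ : ∃ u ∉ 𝔭, ∃ w v : S, u * β = Q * w + x * v := by
    obtain ⟨δ, hδ⟩ := hQβ
    obtain ⟨δ', rfl⟩ := Ideal.Quotient.mk_surjective δ
    rw [hπ, hπ, ← map_mul, Ideal.Quotient.eq, Ideal.mem_span_singleton] at hδ
    obtain ⟨γ, hγ⟩ := hδ
    obtain ⟨⟨dn, ⟨ds, hds⟩⟩, hdmk⟩ := IsLocalization.mk'_surjective 𝔭.primeCompl δ'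
    obtain ⟨⟨gn, ⟨gs, hgs⟩⟩, hgmk⟩ := IsLocalization.mk'_surjective 𝔭.primeCompl γ
    simp only at hdmk hgmk
    refine ⟨ds * gs, fun h => ((h𝔭.mem_or_mem h).elim hds hgs), -(dn * gs), -(gn * ds), hφinj ?_⟩
    -- `φ(−β) − φ Q · δ' = φ x · γ`, cleared of denominators
    have h1 : φ (-β) * φ ds * φ gs = (φ Q * φ dn) * φ gs + (φ x * φ gn) * φ ds := by
      have := hγ
      rw [← hdmk, ← hgmk] at this
      have e1 : φ Q * φ dn = φ Q * IsLocalization.mk' R dn ⟨ds, hds⟩ * φ ds := by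
        rw [mul_assoc, IsLocalization.mk'_spec_mk]
      have e2 : φ x * φ gn = φ x * IsLocalization.mk' R gn ⟨gs, hgs⟩ * φ gs := by
        rw [mul_assoc, IsLocalization.mk'_spec_mk]
      rw [e1, e2]
      have e3 : φ (-β) = φ Q * IsLocalization.mk' R dn ⟨ds, hds⟩ + φ x * IsLocalization.mk' R gn ⟨gs, hgs⟩ :=
        sub_eq_iff_eq_add'.mp this
      rw [e3]; ring
    simp only [map_mul, map_add, map_neg] at h1 ⊢
    linear_combination -h1
  -- display (∗∗): `(u y) θ_i + x v ∈ (q i)`; dividing by `x` gives `u t x^{e'} ∈ Λ`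
  have hnew : ∀ i, (u * t * x ^ e') * θ i + v ∈ Ideal.span {q i} := by
    intro i
    rw [hmem]
    have h1 : q i ∣ u * (y * θ i + β) := Dvd.dvd.mul_left ((hmem i _).mp (hβ i)) u
    have h2 : q i ∣ Q * w := (hqQ i).mul_right w
    -- `u (yθ + β) − Q w = x · ((u t x^{e'}) θ + v)`
    have h3 : u * (y * θ i + β) - Q * w = x * ((u * t * x ^ e') * θ i + v) := by
      rw [hydef, hee', pow_succ]
      linear_combination huβ
    have h4 : q i ∣ x * ((u * t * x ^ e') * θ i + v) := by rw [← h3]; exact dvd_sub h1 h2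
    exact ((hq i).dvd_or_dvd h4).resolve_left (hxdvd i)
  have hΛ'' : u * t * x ^ e' ∈ Λ := (hΛ _).mpr ⟨v, hnew⟩
  -- contradiction with the minimality of `e`
  have hmem' : φ (u * t) * φ x ^ e' ∈ Λ' := by
    rw [← map_pow, ← map_mul]; exact Ideal.mem_map_of_mem φ hΛ''
  have hut : IsUnit (φ (u * t)) := hφunit _ fun h => (h𝔭.mem_or_mem h).elim hu ht𝔭
  exact hemin e' (by omega) ((Ideal.unit_mul_mem_iff_mem Λ' hut).mp hmem')

end Mulay1983

end Literature.AlgebraicGeometry.Resolution
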